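import Summits.Langlands.Langlands.Theses.RepeatedRootSocle
import Literature.NumberTheory.Automorphic.OrdinaryPolarizedAutomorphicLimit

/-!
# Birth skeleton (BC3) for crux stmt-Langlands-18145
`Summit.Langlands.Langlands.Theses.RepeatedRootSocle.PadicLimitUnrefinedR` — line `birth`

Route `route-Langlands-RepeatedRootSocle` (crux #3, rank 3, "p-ADIC AUTOMORPHY WITHOUT REFINEMENT", repaired
typing: multiplier `ε`, homological convention). The crux: for `p` odd, `ρ₀, ρ : Γ_ℚ → GL₄(ℚ̄_p)` irreducible,
symplectic with multiplier `ε`, of Siegel-parabolic weight-2 ordinary shape `(εα, εβ | β⁻¹, α⁻¹)` at the place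
above `p` (unramified `α, β`, NO condition `α ≠ β`), pure a.e.; `ρ` residually enormous; `ρ₀` automorphic and
congruent to `ρ` a.e. ⟹ `Lim ρ`: for every `m` there is an automorphic `ρ_m` whose integral Frobenius polynomials
are `≡` those of `ρ` modulo `p^m` at almost all places.

The line `birth` cuts the crux along the printed architecture of Boxer–Calegari–Gee–Pilloni 2025
(arXiv:2502.20645), §7 intro (p. 104 of the held text: "multiplicity one really consists of two separate
statements — firstly that the multiplicity is at least one (a p-adic modularity statement) …") and the proof of
Prop. 374 (= Prop. 7.5.7; pp. 118–120: "every irreducible component … dominates an irreducible component of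
`Spec Λ` … a dense set of closed points of `R`-regular classical weight … Theorem (GSp₄ `p > 2` automorphy lifting)
… at a dense set of closed points of `R`-regular classical weight … consequently `M_𝔮` is nonzero"), by the
dichotomy of their Definition 1.8.8 (p. 8: `ρ` is `p`-DISTINGUISHED iff the four characters
`χ₁, χ₂, ε⁻¹χ₂⁻¹, ε⁻¹χ₁⁻¹` are pairwise distinct — for unramified `χ₁, χ₂` in characteristic 0: iff `α ≠ β`):

* `stub_distinctRoots` — **the `p`-distinguished case is automorphic outright** (L; in print modulo image
  hypotheses). Under the crux hypotheses and a `P`-ordinary presentation of `ρ` at a place above `p` with `α ≠ β`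
  (BCGP 2025's `p`-distinguished in characteristic zero; residual distinctness NOT required), `ρ` is automorphic
  (`Aut ρ`): BCGP 2025 Prop. 374 + Thm. 375 (= Thm. 7.5.8), which contain the residually `p`-distinguished case of
  BCGP 2021. A constant sequence is a `p`-adic limit, so this case of the crux needs no family.
* `stub_repeatedRootApproximation` — **at a repeated-root point, `ρ` is a `p`-adic limit of REGULAR-weight
  `B`-ordinary symplectic Galois representations with the same residual representation** (L/XL; the NEW content,
  isolated to exactly the regime the route exists for). Under the crux hypotheses and `α = β` for the presentations
  at the places above `p`: for every `m` there is `r' : Γ_ℚ → GL₄(ℚ̄_p)`, symplectic with multiplier `ε`,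
  cyclotomic-ordinary with STRICTLY DECREASING exponents at the places above `p`
  (`FramedGaloisRep.IsCyclotomicOrdinaryAt`, the accepted "crystalline-ordinary of regular weight" clause),
  unramified a.e., residually enormous, residually congruent to `ρ₀`, and `≡ ρ (mod p^m)` a.e. Intended proof:
  the component `Q ∋ 𝔮_ρ` of the global ordinary deformation ring `R_𝒮` is finite over `Λ_{GSp₄,ℚ}` (BCGP 2025
  Thm. 329 = the `R^red = T` theorem of §6.3 over the two-variable Hida family, stated WITHOUT residual
  `p`-distinguishedness, via Whitmore's patching) and has dimension `≥ dim Λ` (their Lemma "lower bound for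
  dimension of generic fibre"), hence surjects onto weight space; the local input at a CROSSING point is their
  Lemma 324 (an ordinary pure weight-2 crystalline lift lies on a unique component of `Spec R_p^△` — the fibre of
  flags over it is a `P¹` exactly when Frobenius is scalar on `Fil₂`, i.e. `α = β`, and is connected either way) and
  Lemma 325 (Ihara avoidance); finiteness + equidimensionality turn Zariski density of `R`-regular classical
  weights into `p`-adic approximation of the point `ρ`. This is the half of Prop. 374 that p. 104 says holds
  "at least in principle" without `p`-distinguishedness; the other half (rank `≤ 1`, regularity of `(R_𝒮)_𝔮`) is
  what needs `α ≠ β` and is NOT on this crux (it is the heart `LimitClassicalUnrefinedR`).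
* `stub_regularWeightLifting` — **regular-weight ordinary symplectic automorphy lifting over `ℚ` with residual
  automorphy from a weight-2 `P`-ordinary source** (L; known technology: BCGP 2025 Thm. 329 / §6.3 "an ordinary
  modularity lifting theorem for GSp₄, `p > 2`" at `R`-regular classical points + Hida's control in cohomological
  weight; BCGP 2021 §7–8; Whitmore 2022; classically Pilloni 2012, Tilouine 2006, Genestier–Tilouine 2005).
  For `ρ₀` as in the crux (irreducible, symplectic-`ε`, `P`-ordinary weight-2 shape above `p`, pure, automorphic)
  and `r` symplectic-`ε`, cyclotomic-ordinary of regular weight above `p`, unramified a.e., residually enormous and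
  residually congruent to `ρ₀`: `r` is automorphic (`Aut r`, the crux's own weak GL₄ sense).
* `PadicLimitUnrefinedR_of` — the composition, kernel-checked, concluding the route decl BY NAME: case split on
  the existence of a `p`-distinguished presentation above `p`; if yes, `stub_distinctRoots` gives `Aut ρ` and the
  constant sequence `ρ_m := ρ` witnesses `Lim ρ` (integral polynomials from `Cong ρ₀ ρ`); if no, every
  `P`-ordinary presentation supplied by `PSh ρ v` has `α = β`, `stub_repeatedRootApproximation` gives regular
  ordinary approximants `r'_m` and `stub_regularWeightLifting` makes each automorphic.

Disproof used: `Cruxes/PadicLimitUnrefinedR/Disproof.lean` (refuter `rattack-stmt-Langlands-18145`, 2026-08-17,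
read at registration): NO KILL — no `_false_without_` theorem, no refuted strengthening, no tightness lemma, no
`Negative/` landing; its POSITIVE lemmas are honoured/used as follows: `padicLimitUnrefinedR_of_unrefinedWeightTwoLiftingR`
(target → crux by the constant sequence) is exactly the step of the distinguished branch of `PadicLimitUnrefinedR_of`
below; `padicLimitUnrefinedR_iff_fromTwo` (levels `m ≤ 1` are free, witness `ρ₀`) does not trivialise any stub —
`stub_repeatedRootApproximation` asks for REGULAR-weight approximants at every level, which `ρ₀` (weight 2) is not;
`eq_map_int_of_hasFrobCharpolyAt` / `frobCharpoly_cong_mod_p` are the bookkeeping a prover of stub 2 needs for the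
`BigRes r' ∧ Cong ρ₀ r'` clauses at level `max m 1`. The disproof of the SUPERSEDED decl
(`Cruxes/PadicLimitUnrefined/Disproof.lean`: the rev-≤4 typing with multiplier `ε⁻¹` is vacuous, `det² = ε⁻⁴` against
`P(0) ∈ ℤ`) is honoured: every stub uses the repaired multiplier `ε` of the R-decl (`Sympl` verbatim); the approximants
of stubs 2–3 carry `IsCyclotomicOrdinaryAt` + symplectic-`ε` (determinant `ψ·ε²`, `ψ` unramified — consistent) and an
a.e.-UNRAMIFIED clause instead of an integral-purity clause (the refuter's note that the unramified half of `Pure` is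
load-bearing for `Lim` is why `AEUnram` is kept), so no determinant/integrality clash can be replayed on them.
Negatives index: the refuted statements of this summit (`ledger negatives --problem Langlands`) are not instances of
any stub (all three keep rank 4, base `ℚ`, `p ≠ 2`, and the residual-enormous + congruence clauses that exclude sums
of characters as witnesses).

Shape (for `ledger skeleton check` / `#h21_check_skeleton`): stubs `theorem stub_<name> : <signature> := by sorry`
stated over tree declarations only (fully qualified, the crux's `let`-vocabulary copied verbatim and extended by
`DistAt` / `RepAt` (the two cases of `PSh`), `CycOrd`, `AEUnram`, `CongMod` (= the inner clause of `Lim`));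
`_Goal.stub_<name> : Prop := type_of% @stub_<name>` names each statement;
`PadicLimitUnrefinedR_of (h1 : _Goal.stub_distinctRoots) (h2 : _Goal.stub_repeatedRootApproximation)
(h3 : _Goal.stub_regularWeightLifting) : PadicLimitUnrefinedR` is proved without `sorry`.
-/

set_option linter.dupNamespace false
set_option linter.unusedVariables false

noncomputable section

namespace Summit.Langlands.Langlands.Cruxes.PadicLimitUnrefinedR.Birth

/-! ## 1. The three stubs -/

/-- **STUB 1 — the `p`-distinguished case (`α ≠ β`) is automorphic outright (L; in print modulo image hypotheses).**
Binders and `let`-vocabulary of the crux verbatim, plus `DistAt r v`: a Siegel-parabolic weight-2 ordinary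
presentation of `r|Γ_{ℚ_v}` (the clause `PSh` of the crux) whose unramified characters satisfy `α τ ≠ β τ` for some
`τ` — Boxer–Calegari–Gee–Pilloni's "`p`-distinguished" in characteristic zero (the four characters
`εα, εβ, β⁻¹, α⁻¹` pairwise distinct; `ε` being infinitely ramified this is `α ≠ β`). CLAIM: under the hypotheses of
the crux (`ρ₀` automorphic, congruent a.e. to `ρ`; both irreducible, symplectic-`ε`, `P`-ordinary weight 2 above `p`,
pure; `ρ` residually enormous) and `DistAt ρ v` at some place `v ∋ p`, `ρ` is automorphic in the crux's sense `Aut`.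
This is BCGP 2025 Prop. 374 (`M_𝔮` free of rank one, `p > 2` alternative: residual automorphy from an ORDINARY
cuspidal `π` of `GSp₄/ℚ`, `ρ̄` `GSp₄`-reasonable and tidy, a regular semisimple element outside `Sp₄`, same local
component at `p`) + Thm. 375 (= Thm. 7.5.8: then `ρ` is modular) + `GSp₄ → GL₄` transfer; it CONTAINS the residually
`p`-distinguished theorem of BCGP 2021 (§1.1.1 "Our modularity lifting theorem", Thm. 6 of the held TeX numbering =
Thm. 1.1.6: "unit root crystalline eigenvalues distinct modulo p"; proved as Theorem `thm: final R equals T`, §8.4). Why it might fail as typed: `BigRes` (irreducible + one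
regular semisimple element) is weaker than reasonable/tidy/integrally enormous; `Aut ρ₀` records no ordinarity of
`π₀` (to be re-derived from `PSh ρ₀` by local–global compatibility at `p` in weight `(2,2)`); `p = 3` small-image
corners — exactly the caveats already recorded on the target `UnrefinedWeightTwoLiftingR`.
[cite: BoxerCalegariGeePilloni2025, Def. 1.8.8 (p-distinguished), Prop. 374 (= 7.5.7) and Thm. 375 (= 7.5.8), §7 intro]
[cite: BoxerEtAl2021, §1.1.1 Thm. 1.1.6 (= Thm. 6), §8.4 (the main modularity lifting theorem), §7.3 Def. 7.3.1 (residually p-distinguished)] [cite: GeeTaibi2019, Thm. 1 (transfer to GL₄)] -/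
theorem stub_distinctRoots :
    ∀ (p : ℕ) [Fact p.Prime], p ≠ 2 →
      ∀ (k : Type) [Field k] [CharP k p] [IsAlgClosed k] [TopologicalSpace k] [DiscreteTopology k]
        (red : Valued.integer (PadicAlgCl p) →+* k)
        (hcpt : Literature.NumberTheory.Automorphic.isCompact_glFiniteIntegralLevel 4 ℚ) (ι : PadicAlgCl p ≃+* ℂ),
      let R4 := Literature.NumberTheory.GaloisRepresentations.FramedGaloisRep ℚ (PadicAlgCl p) 4;
      let Pl := IsDedekindDomain.HeightOneSpectrum (NumberField.RingOfIntegers ℚ);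
      ∀ (ρ₀ ρ : R4),
      let Sympl := fun r : R4 => r.IsSymplecticWithMultiplierFun (fun g => algebraMap ℚ_[p] (PadicAlgCl p) (((Literature.NumberTheory.GaloisRepresentations.GaloisRep.cyclotomicCharacter ℚ p g : ℤ_[p]ˣ) : ℤ_[p]) : ℚ_[p]));
      let PSh := fun (r : R4) (v : Pl) => ∃ (g : Matrix.GeneralLinearGroup (Fin 4) (PadicAlgCl p))
          (α β : Field.absoluteGaloisGroup (v.adicCompletion ℚ) →* (PadicAlgCl p)ˣ),
          (∀ τ ∈ Literature.NumberTheory.GaloisRepresentations.absInertia (v.adicCompletion ℚ), α τ = 1 ∧ β τ = 1) ∧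
          ∀ τ, (∀ i j : Fin 4, j < i → (g⁻¹ * r.toLocal v τ * g).val i j = 0) ∧
            (g⁻¹ * r.toLocal v τ * g).val 0 1 = 0 ∧ (g⁻¹ * r.toLocal v τ * g).val 2 3 = 0 ∧
            (g⁻¹ * r.toLocal v τ * g).val 0 0 = algebraMap ℚ_[p] (PadicAlgCl p) (((Literature.NumberTheory.GaloisRepresentations.GaloisRep.cyclotomicCharacter (v.adicCompletion ℚ) p τ : ℤ_[p]ˣ) : ℤ_[p]) : ℚ_[p]) * α τ ∧
            (g⁻¹ * r.toLocal v τ * g).val 1 1 = algebraMap ℚ_[p] (PadicAlgCl p) (((Literature.NumberTheory.GaloisRepresentations.GaloisRep.cyclotomicCharacter (v.adicCompletion ℚ) p τ : ℤ_[p]ˣ) : ℤ_[p]) : ℚ_[p]) * β τ ∧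
            (g⁻¹ * r.toLocal v τ * g).val 2 2 = ((β τ)⁻¹ : (PadicAlgCl p)ˣ) ∧ (g⁻¹ * r.toLocal v τ * g).val 3 3 = ((α τ)⁻¹ : (PadicAlgCl p)ˣ);
      let Pure := fun r : R4 => ∀ᶠ v : Pl in Filter.cofinite, r.IsUnramifiedAt v ∧ ∃ P : Polynomial ℤ,
          r.HasFrobCharpolyAt v (P.map (Int.castRingHom (PadicAlgCl p))) ∧
          ∀ z : ℂ, (P.map (Int.castRingHom ℂ)).IsRoot z → ‖z‖ ^ 2 = (v.residueCard : ℝ);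
      let Cong := fun r r' : R4 => ∀ᶠ v : Pl in Filter.cofinite, ∃ P P' : Polynomial (Valued.integer (PadicAlgCl p)),
          r.HasFrobCharpolyAt v (P.map (Valued.integer (PadicAlgCl p)).subtype) ∧
          r'.HasFrobCharpolyAt v (P'.map (Valued.integer (PadicAlgCl p)).subtype) ∧ P.map red = P'.map red;
      let BigRes := fun r : R4 => ∃ σ : Literature.NumberTheory.GaloisRepresentations.FramedGaloisRep ℚ k 4,
          (∀ᶠ v : Pl in Filter.cofinite, ∃ (P : Polynomial (Valued.integer (PadicAlgCl p))) (Pb : Polynomial k),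
            r.HasFrobCharpolyAt v (P.map (Valued.integer (PadicAlgCl p)).subtype) ∧ σ.HasFrobCharpolyAt v Pb ∧ P.map red = Pb) ∧
          σ.toGaloisRep.IsIrreducible ∧ ∃ x, ((σ x).val.charpoly).Separable;
      let Aut := fun r : R4 => ∃ π : Literature.NumberTheory.Automorphic.CuspidalAutomorphicRepData 4 ℚ hcpt, π.1.IsLAlgebraic ∧
          ∀ᶠ v : Pl in Filter.cofinite, ∃ a : Multiset ℂ, π.1.HasSatakeParamAt v a ∧ r.IsUnramifiedAt v ∧
            r.HasFrobCharpolyAt v (Literature.NumberTheory.Automorphic.arithFrobPolyOfSatake ι v.residueCard 1 a);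
      let DistAt := fun (r : R4) (v : Pl) => ∃ (g : Matrix.GeneralLinearGroup (Fin 4) (PadicAlgCl p))
          (α β : Field.absoluteGaloisGroup (v.adicCompletion ℚ) →* (PadicAlgCl p)ˣ),
          (∀ τ ∈ Literature.NumberTheory.GaloisRepresentations.absInertia (v.adicCompletion ℚ), α τ = 1 ∧ β τ = 1) ∧ (∃ τ, α τ ≠ β τ) ∧
          ∀ τ, (∀ i j : Fin 4, j < i → (g⁻¹ * r.toLocal v τ * g).val i j = 0) ∧
            (g⁻¹ * r.toLocal v τ * g).val 0 1 = 0 ∧ (g⁻¹ * r.toLocal v τ * g).val 2 3 = 0 ∧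
            (g⁻¹ * r.toLocal v τ * g).val 0 0 = algebraMap ℚ_[p] (PadicAlgCl p) (((Literature.NumberTheory.GaloisRepresentations.GaloisRep.cyclotomicCharacter (v.adicCompletion ℚ) p τ : ℤ_[p]ˣ) : ℤ_[p]) : ℚ_[p]) * α τ ∧
            (g⁻¹ * r.toLocal v τ * g).val 1 1 = algebraMap ℚ_[p] (PadicAlgCl p) (((Literature.NumberTheory.GaloisRepresentations.GaloisRep.cyclotomicCharacter (v.adicCompletion ℚ) p τ : ℤ_[p]ˣ) : ℤ_[p]) : ℚ_[p]) * β τ ∧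
            (g⁻¹ * r.toLocal v τ * g).val 2 2 = ((β τ)⁻¹ : (PadicAlgCl p)ˣ) ∧ (g⁻¹ * r.toLocal v τ * g).val 3 3 = ((α τ)⁻¹ : (PadicAlgCl p)ˣ);
      ρ₀.toGaloisRep.IsIrreducible → Sympl ρ₀ → (∀ v : Pl, ((p : ℕ) : NumberField.RingOfIntegers ℚ) ∈ v.asIdeal → PSh ρ₀ v) → Pure ρ₀ → Aut ρ₀ →
      ρ.toGaloisRep.IsIrreducible → Sympl ρ → (∀ v : Pl, ((p : ℕ) : NumberField.RingOfIntegers ℚ) ∈ v.asIdeal → PSh ρ v) → Pure ρ → BigRes ρ →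
      Cong ρ₀ ρ →
      (∃ v : Pl, ((p : ℕ) : NumberField.RingOfIntegers ℚ) ∈ v.asIdeal ∧ DistAt ρ v) → Aut ρ := by
  sorry

/-- **STUB 2 — at a repeated-root point `ρ` is a `p`-adic limit of REGULAR-weight `B`-ordinary symplectic
representations with the same residual representation (L/XL; the new content of the crux).**
Binders and `let`-vocabulary of the crux verbatim, plus: `RepAt r v` (a `PSh`-presentation with `α = β`: the
repeated unit root), `CycOrd r` (at every place above `p`, `r` is cyclotomic-ordinary with STRICTLY DECREASING
exponents — accepted `FramedGaloisRep.IsCyclotomicOrdinaryAt`: some frame is upper triangular with diagonal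
`ψ_i ε^{b_i}`, `ψ_i` unramified, `b₀ > b₁ > b₂ > b₃`; with multiplier `ε` this forces `b₀ + b₃ = b₁ + b₂ = 1`, i.e. a
cohomological Siegel weight), `AEUnram r` (unramified a.e.), `CongMod m r r'` (integral Frobenius polynomials
`≡ (mod p^m)` a.e. — the inner clause of the crux's `Lim`). CLAIM: under the crux hypotheses and `RepAt ρ v` for all
`v ∋ p`, for every `m` there is `r'` with `Sympl r' ∧ CycOrd r' ∧ AEUnram r' ∧ BigRes r' ∧ Cong ρ₀ r' ∧ CongMod m ρ r'`
(the last three at level `max m 1` make the first two residual clauses automatic; they are listed so that STUB 3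
applies verbatim). Intended proof (BCGP 2025, proof of Prop. 374, `p > 2`, first half — the half p. 104 says works
"at least in principle" without `p`-distinguishedness): with `𝒮₁` the global ordinary deformation problem over the
two-variable weight space `Λ_{GSp₄,ℚ}` and `Q ⊆ 𝔮_ρ` a minimal prime of `R_𝒮`, `R_{𝒮₁}/Q` is finite over `Λ`
(Thm. 329: `R_{𝒮₁,π}` finite over `Λ`, `(R_{𝒮₁,π})^red ≅ T_{𝒮₁,π}`, proved WITHOUT residual `p`-distinguishedness via
Whitmore's patching) and of dimension `≥ dim Λ` (Lemma "lower bound for dimension of generic fibre"), so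
`Spec R_{𝒮₁}/Q → Spec Λ` is surjective and `R`-regular classical weights are dense on the component; the local
input at the crossing point is Lemma 324 (an ordinary pure weight-2 crystalline lift lies on a unique component of
`Spec R_p^△`; the fibre of symplectic flags over it is `P¹` when Frobenius is scalar on `Fil₂` — i.e. `α = β` — and
connected either way) with Lemma 325 (Ihara avoidance); finiteness + equidimensionality of the component at `𝔮_ρ`
upgrade Zariski density to `p`-adic approximation of the point `ρ` by regular-weight points `r'_m`, which are
`B`-ordinary of regular weight (`CycOrd`), symplectic-`ε` (fixed central character `|·|²`), unramified outside `S`.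
Why it might fail: at `α = β` the point `𝔮_ρ` may lie on two components of `Spec R_𝒮[1/p]` and each needs the
surjection; `p`-adic (not Zariski) approximation needs the finite map to be open at `𝔮_ρ` on its component;
semistable-but-not-crystalline `ρ` (bad multiplicative reduction) is outside Lemma 324; image hypotheses as in STUB 1.
[cite: BoxerCalegariGeePilloni2025, proof of Prop. 374 (= 7.5.7, p > 2 case), Thm. 329 (§6.3), Lemma 324, Lemma 325, §7 intro (p-adic modularity = multiplicity ≥ 1)]
[cite: Whitmore2022, Thm. A (Taylor–Wiles patching for GSp₄ Hida families)] [cite: BoxerEtAl2021, §7 (𝒟_v^1, Λ-adic ordinary deformation rings)] -/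
theorem stub_repeatedRootApproximation :
    ∀ (p : ℕ) [Fact p.Prime], p ≠ 2 →
      ∀ (k : Type) [Field k] [CharP k p] [IsAlgClosed k] [TopologicalSpace k] [DiscreteTopology k]
        (red : Valued.integer (PadicAlgCl p) →+* k)
        (hcpt : Literature.NumberTheory.Automorphic.isCompact_glFiniteIntegralLevel 4 ℚ) (ι : PadicAlgCl p ≃+* ℂ),
      let R4 := Literature.NumberTheory.GaloisRepresentations.FramedGaloisRep ℚ (PadicAlgCl p) 4;
      let Pl := IsDedekindDomain.HeightOneSpectrum (NumberField.RingOfIntegers ℚ);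
      ∀ (ρ₀ ρ : R4),
      let Sympl := fun r : R4 => r.IsSymplecticWithMultiplierFun (fun g => algebraMap ℚ_[p] (PadicAlgCl p) (((Literature.NumberTheory.GaloisRepresentations.GaloisRep.cyclotomicCharacter ℚ p g : ℤ_[p]ˣ) : ℤ_[p]) : ℚ_[p]));
      let PSh := fun (r : R4) (v : Pl) => ∃ (g : Matrix.GeneralLinearGroup (Fin 4) (PadicAlgCl p))
          (α β : Field.absoluteGaloisGroup (v.adicCompletion ℚ) →* (PadicAlgCl p)ˣ),
          (∀ τ ∈ Literature.NumberTheory.GaloisRepresentations.absInertia (v.adicCompletion ℚ), α τ = 1 ∧ β τ = 1) ∧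
          ∀ τ, (∀ i j : Fin 4, j < i → (g⁻¹ * r.toLocal v τ * g).val i j = 0) ∧
            (g⁻¹ * r.toLocal v τ * g).val 0 1 = 0 ∧ (g⁻¹ * r.toLocal v τ * g).val 2 3 = 0 ∧
            (g⁻¹ * r.toLocal v τ * g).val 0 0 = algebraMap ℚ_[p] (PadicAlgCl p) (((Literature.NumberTheory.GaloisRepresentations.GaloisRep.cyclotomicCharacter (v.adicCompletion ℚ) p τ : ℤ_[p]ˣ) : ℤ_[p]) : ℚ_[p]) * α τ ∧
            (g⁻¹ * r.toLocal v τ * g).val 1 1 = algebraMap ℚ_[p] (PadicAlgCl p) (((Literature.NumberTheory.GaloisRepresentations.GaloisRep.cyclotomicCharacter (v.adicCompletion ℚ) p τ : ℤ_[p]ˣ) : ℤ_[p]) : ℚ_[p]) * β τ ∧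
            (g⁻¹ * r.toLocal v τ * g).val 2 2 = ((β τ)⁻¹ : (PadicAlgCl p)ˣ) ∧ (g⁻¹ * r.toLocal v τ * g).val 3 3 = ((α τ)⁻¹ : (PadicAlgCl p)ˣ);
      let Pure := fun r : R4 => ∀ᶠ v : Pl in Filter.cofinite, r.IsUnramifiedAt v ∧ ∃ P : Polynomial ℤ,
          r.HasFrobCharpolyAt v (P.map (Int.castRingHom (PadicAlgCl p))) ∧
          ∀ z : ℂ, (P.map (Int.castRingHom ℂ)).IsRoot z → ‖z‖ ^ 2 = (v.residueCard : ℝ);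
      let Cong := fun r r' : R4 => ∀ᶠ v : Pl in Filter.cofinite, ∃ P P' : Polynomial (Valued.integer (PadicAlgCl p)),
          r.HasFrobCharpolyAt v (P.map (Valued.integer (PadicAlgCl p)).subtype) ∧
          r'.HasFrobCharpolyAt v (P'.map (Valued.integer (PadicAlgCl p)).subtype) ∧ P.map red = P'.map red;
      let BigRes := fun r : R4 => ∃ σ : Literature.NumberTheory.GaloisRepresentations.FramedGaloisRep ℚ k 4,
          (∀ᶠ v : Pl in Filter.cofinite, ∃ (P : Polynomial (Valued.integer (PadicAlgCl p))) (Pb : Polynomial k),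
            r.HasFrobCharpolyAt v (P.map (Valued.integer (PadicAlgCl p)).subtype) ∧ σ.HasFrobCharpolyAt v Pb ∧ P.map red = Pb) ∧
          σ.toGaloisRep.IsIrreducible ∧ ∃ x, ((σ x).val.charpoly).Separable;
      let Aut := fun r : R4 => ∃ π : Literature.NumberTheory.Automorphic.CuspidalAutomorphicRepData 4 ℚ hcpt, π.1.IsLAlgebraic ∧
          ∀ᶠ v : Pl in Filter.cofinite, ∃ a : Multiset ℂ, π.1.HasSatakeParamAt v a ∧ r.IsUnramifiedAt v ∧
            r.HasFrobCharpolyAt v (Literature.NumberTheory.Automorphic.arithFrobPolyOfSatake ι v.residueCard 1 a);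
      let RepAt := fun (r : R4) (v : Pl) => ∃ (g : Matrix.GeneralLinearGroup (Fin 4) (PadicAlgCl p))
          (α β : Field.absoluteGaloisGroup (v.adicCompletion ℚ) →* (PadicAlgCl p)ˣ),
          (∀ τ ∈ Literature.NumberTheory.GaloisRepresentations.absInertia (v.adicCompletion ℚ), α τ = 1 ∧ β τ = 1) ∧ (∀ τ, α τ = β τ) ∧
          ∀ τ, (∀ i j : Fin 4, j < i → (g⁻¹ * r.toLocal v τ * g).val i j = 0) ∧
            (g⁻¹ * r.toLocal v τ * g).val 0 1 = 0 ∧ (g⁻¹ * r.toLocal v τ * g).val 2 3 = 0 ∧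
            (g⁻¹ * r.toLocal v τ * g).val 0 0 = algebraMap ℚ_[p] (PadicAlgCl p) (((Literature.NumberTheory.GaloisRepresentations.GaloisRep.cyclotomicCharacter (v.adicCompletion ℚ) p τ : ℤ_[p]ˣ) : ℤ_[p]) : ℚ_[p]) * α τ ∧
            (g⁻¹ * r.toLocal v τ * g).val 1 1 = algebraMap ℚ_[p] (PadicAlgCl p) (((Literature.NumberTheory.GaloisRepresentations.GaloisRep.cyclotomicCharacter (v.adicCompletion ℚ) p τ : ℤ_[p]ˣ) : ℤ_[p]) : ℚ_[p]) * β τ ∧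
            (g⁻¹ * r.toLocal v τ * g).val 2 2 = ((β τ)⁻¹ : (PadicAlgCl p)ˣ) ∧ (g⁻¹ * r.toLocal v τ * g).val 3 3 = ((α τ)⁻¹ : (PadicAlgCl p)ˣ);
      let CycOrd := fun r : R4 => ∀ v : Pl, ((p : ℕ) : NumberField.RingOfIntegers ℚ) ∈ v.asIdeal →
          Literature.NumberTheory.GaloisRepresentations.FramedGaloisRep.IsCyclotomicOrdinaryAt v r;
      let AEUnram := fun r : R4 => ∀ᶠ v : Pl in Filter.cofinite, r.IsUnramifiedAt v;
      let CongMod := fun (m : ℕ) (r r' : R4) => ∀ᶠ v : Pl in Filter.cofinite, ∃ P P' : Polynomial (Valued.integer (PadicAlgCl p)),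
          r.HasFrobCharpolyAt v (P.map (Valued.integer (PadicAlgCl p)).subtype) ∧
          r'.HasFrobCharpolyAt v (P'.map (Valued.integer (PadicAlgCl p)).subtype) ∧
          ∀ i : ℕ, ((p : ℕ) : Valued.integer (PadicAlgCl p)) ^ m ∣ (P - P').coeff i;
      ρ₀.toGaloisRep.IsIrreducible → Sympl ρ₀ → (∀ v : Pl, ((p : ℕ) : NumberField.RingOfIntegers ℚ) ∈ v.asIdeal → PSh ρ₀ v) → Pure ρ₀ → Aut ρ₀ →
      ρ.toGaloisRep.IsIrreducible → Sympl ρ → (∀ v : Pl, ((p : ℕ) : NumberField.RingOfIntegers ℚ) ∈ v.asIdeal → PSh ρ v) → Pure ρ → BigRes ρ →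
      Cong ρ₀ ρ →
      (∀ v : Pl, ((p : ℕ) : NumberField.RingOfIntegers ℚ) ∈ v.asIdeal → RepAt ρ v) →
      ∀ m : ℕ, ∃ r' : R4, Sympl r' ∧ CycOrd r' ∧ AEUnram r' ∧ BigRes r' ∧ Cong ρ₀ r' ∧ CongMod m ρ r' := by
  sorry

/-- **STUB 3 — regular-weight ordinary symplectic automorphy lifting over `ℚ`, residual automorphy from a weight-2
`P`-ordinary source (L; known technology).**
Binders and `let`-vocabulary of the crux verbatim (second representation renamed `r`), plus `CycOrd`, `AEUnram` as in
STUB 2. CLAIM: if `ρ₀` is irreducible, symplectic-`ε`, `P`-ordinary of weight 2 above `p`, pure and automorphic, and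
`r : Γ_ℚ → GL₄(ℚ̄_p)` is symplectic-`ε`, cyclotomic-ordinary of REGULAR weight above `p` (strictly decreasing
exponents), unramified a.e., residually enormous (`BigRes r`) and residually congruent to `ρ₀` (`Cong ρ₀ r`), then `r`
is automorphic (`Aut r`: an `L`-algebraic cuspidal `π` on `GL₄/ℚ` with Satake = arithmetic Frobenius a.e.). Intended
proof: the weight-2 `P`-ordinary source gives an ordinary cuspidal `π₀` on `GSp₄/ℚ` (Arthur / Gee–Taïbi descent from
`GL₄`; ordinarity of `π₀,p` from `PSh ρ₀`), whose `B`-ordinary refinement lies in the two-variable Hida family; BCGP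
2025 Thm. 329 (`(R_{𝒮₁,π₀})^red ≅ T_{𝒮₁,π₀}`, finite over `Λ`, no residual `p`-distinguishedness) puts `r` on
`Spec T_{𝒮₁,π₀}` (the local component condition at `p` is Lemma 324/325), and at an `R`-regular classical weight a
`T_{𝒮₁}`-eigensystem is a classical cuspidal Siegel eigenform by Hida's control theorem for ordinary coherent `H⁰` in
cohomological weight (BCGP 2021 / Pilloni), automorphic, transferred to `GL₄`. (Equivalently: BCGP 2025 §6.3 +
Prop. "descent to symplectic plus base change" (3), used in the proof of Prop. 374 "at a dense set of closed points of
`R`-regular classical weight".) Why it might fail: image hypotheses (`BigRes` vs `GSp₄`-reasonable + tidy); the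
component hypothesis "ρ_{π,p}|_{G_{ℚ_p}} and r|_{G_{ℚ_p}} on the same component of `Spec R_p^△`" is only known to be
automatic in the residually `p`-distinguished case (BCGP 2025 Rem. 327) — for `ᾱ = β̄` it is Lemma 324 at weight-2
crystalline points and OPEN in general at regular points not known to be crystalline-on-the-flat-component;
ordinarity of `π₀` is not recorded in `Aut ρ₀`.
[cite: BoxerCalegariGeePilloni2025, Thm. 329 (§6.3, Hypothesis 326, Rem. 327), proof of Prop. 374, Lemma 324–325]
[cite: BoxerEtAl2021, §1.1.1 Thm. 1.1.6 (= Thm. 6), §8.4, §7 (ordinary deformation rings), §4 (Hida theory, control in cohomological weight)]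
[cite: Whitmore2022, Thm. A] [cite: Pilloni2012, Thm. 1.1 (Hida theory / control for GSp₄)] [cite: GeeTaibi2019, Thm. 1] -/
theorem stub_regularWeightLifting :
    ∀ (p : ℕ) [Fact p.Prime], p ≠ 2 →
      ∀ (k : Type) [Field k] [CharP k p] [IsAlgClosed k] [TopologicalSpace k] [DiscreteTopology k]
        (red : Valued.integer (PadicAlgCl p) →+* k)
        (hcpt : Literature.NumberTheory.Automorphic.isCompact_glFiniteIntegralLevel 4 ℚ) (ι : PadicAlgCl p ≃+* ℂ),
      let R4 := Literature.NumberTheory.GaloisRepresentations.FramedGaloisRep ℚ (PadicAlgCl p) 4;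
      let Pl := IsDedekindDomain.HeightOneSpectrum (NumberField.RingOfIntegers ℚ);
      ∀ (ρ₀ r : R4),
      let Sympl := fun r : R4 => r.IsSymplecticWithMultiplierFun (fun g => algebraMap ℚ_[p] (PadicAlgCl p) (((Literature.NumberTheory.GaloisRepresentations.GaloisRep.cyclotomicCharacter ℚ p g : ℤ_[p]ˣ) : ℤ_[p]) : ℚ_[p]));
      let PSh := fun (r : R4) (v : Pl) => ∃ (g : Matrix.GeneralLinearGroup (Fin 4) (PadicAlgCl p))
          (α β : Field.absoluteGaloisGroup (v.adicCompletion ℚ) →* (PadicAlgCl p)ˣ),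
          (∀ τ ∈ Literature.NumberTheory.GaloisRepresentations.absInertia (v.adicCompletion ℚ), α τ = 1 ∧ β τ = 1) ∧
          ∀ τ, (∀ i j : Fin 4, j < i → (g⁻¹ * r.toLocal v τ * g).val i j = 0) ∧
            (g⁻¹ * r.toLocal v τ * g).val 0 1 = 0 ∧ (g⁻¹ * r.toLocal v τ * g).val 2 3 = 0 ∧
            (g⁻¹ * r.toLocal v τ * g).val 0 0 = algebraMap ℚ_[p] (PadicAlgCl p) (((Literature.NumberTheory.GaloisRepresentations.GaloisRep.cyclotomicCharacter (v.adicCompletion ℚ) p τ : ℤ_[p]ˣ) : ℤ_[p]) : ℚ_[p]) * α τ ∧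
            (g⁻¹ * r.toLocal v τ * g).val 1 1 = algebraMap ℚ_[p] (PadicAlgCl p) (((Literature.NumberTheory.GaloisRepresentations.GaloisRep.cyclotomicCharacter (v.adicCompletion ℚ) p τ : ℤ_[p]ˣ) : ℤ_[p]) : ℚ_[p]) * β τ ∧
            (g⁻¹ * r.toLocal v τ * g).val 2 2 = ((β τ)⁻¹ : (PadicAlgCl p)ˣ) ∧ (g⁻¹ * r.toLocal v τ * g).val 3 3 = ((α τ)⁻¹ : (PadicAlgCl p)ˣ);
      let Pure := fun r : R4 => ∀ᶠ v : Pl in Filter.cofinite, r.IsUnramifiedAt v ∧ ∃ P : Polynomial ℤ,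
          r.HasFrobCharpolyAt v (P.map (Int.castRingHom (PadicAlgCl p))) ∧
          ∀ z : ℂ, (P.map (Int.castRingHom ℂ)).IsRoot z → ‖z‖ ^ 2 = (v.residueCard : ℝ);
      let Cong := fun r r' : R4 => ∀ᶠ v : Pl in Filter.cofinite, ∃ P P' : Polynomial (Valued.integer (PadicAlgCl p)),
          r.HasFrobCharpolyAt v (P.map (Valued.integer (PadicAlgCl p)).subtype) ∧
          r'.HasFrobCharpolyAt v (P'.map (Valued.integer (PadicAlgCl p)).subtype) ∧ P.map red = P'.map red;
      let BigRes := fun r : R4 => ∃ σ : Literature.NumberTheory.GaloisRepresentations.FramedGaloisRep ℚ k 4,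
          (∀ᶠ v : Pl in Filter.cofinite, ∃ (P : Polynomial (Valued.integer (PadicAlgCl p))) (Pb : Polynomial k),
            r.HasFrobCharpolyAt v (P.map (Valued.integer (PadicAlgCl p)).subtype) ∧ σ.HasFrobCharpolyAt v Pb ∧ P.map red = Pb) ∧
          σ.toGaloisRep.IsIrreducible ∧ ∃ x, ((σ x).val.charpoly).Separable;
      let Aut := fun r : R4 => ∃ π : Literature.NumberTheory.Automorphic.CuspidalAutomorphicRepData 4 ℚ hcpt, π.1.IsLAlgebraic ∧
          ∀ᶠ v : Pl in Filter.cofinite, ∃ a : Multiset ℂ, π.1.HasSatakeParamAt v a ∧ r.IsUnramifiedAt v ∧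
            r.HasFrobCharpolyAt v (Literature.NumberTheory.Automorphic.arithFrobPolyOfSatake ι v.residueCard 1 a);
      let CycOrd := fun r : R4 => ∀ v : Pl, ((p : ℕ) : NumberField.RingOfIntegers ℚ) ∈ v.asIdeal →
          Literature.NumberTheory.GaloisRepresentations.FramedGaloisRep.IsCyclotomicOrdinaryAt v r;
      let AEUnram := fun r : R4 => ∀ᶠ v : Pl in Filter.cofinite, r.IsUnramifiedAt v;
      ρ₀.toGaloisRep.IsIrreducible → Sympl ρ₀ → (∀ v : Pl, ((p : ℕ) : NumberField.RingOfIntegers ℚ) ∈ v.asIdeal → PSh ρ₀ v) → Pure ρ₀ → Aut ρ₀ →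
      Sympl r → CycOrd r → AEUnram r → BigRes r → Cong ρ₀ r → Aut r := by
  sorry

/-! ## 2. The stub statements as named `Prop`s (literally their types) -/

namespace _Goal

/-- The statement of `stub_distinctRoots`, as a named `Prop` (literally its type). [folklore] -/
def stub_distinctRoots : Prop :=
  type_of% @Summit.Langlands.Langlands.Cruxes.PadicLimitUnrefinedR.Birth.stub_distinctRoots

/-- The statement of `stub_repeatedRootApproximation`, as a named `Prop` (literally its type). [folklore] -/
def stub_repeatedRootApproximation : Prop :=
  type_of% @Summit.Langlands.Langlands.Cruxes.PadicLimitUnrefinedR.Birth.stub_repeatedRootApproximation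

/-- The statement of `stub_regularWeightLifting`, as a named `Prop` (literally its type). [folklore] -/
def stub_regularWeightLifting : Prop :=
  type_of% @Summit.Langlands.Langlands.Cruxes.PadicLimitUnrefinedR.Birth.stub_regularWeightLifting

end _Goal

/-! ## 3. The composition (kernel-checked, no `sorry`): case split on `p`-distinguishedness above `p` -/

/-- **`PadicLimitUnrefinedR` from the three stubs.** Fix the data and hypotheses of the crux. EITHER some place
`v ∋ p` carries a `P`-ordinary presentation of `ρ` with `α ≠ β`: then `stub_distinctRoots` gives `Aut ρ`, and the
constant sequence `ρ_m := ρ` is a `p`-adic limit (the integral polynomials come from `Cong ρ₀ ρ`, congruence to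
itself is `p^m ∣ 0`). OR no place does: then every presentation handed out by `PSh ρ v` has `α τ = β τ` for all `τ`
(else it would be a distinguished one), i.e. `RepAt ρ v` at every `v ∋ p`; `stub_repeatedRootApproximation` gives,
for each `m`, a regular-weight ordinary symplectic `r'` congruent to `ρ` modulo `p^m` with the residual clauses, and
`stub_regularWeightLifting` (fed `ρ₀`'s hypotheses and those clauses) makes `r'` automorphic. The hypotheses are, by
name, the statements of the three stubs; the conclusion is the route decl
`Summit.Langlands.Langlands.Theses.RepeatedRootSocle.PadicLimitUnrefinedR`. [folklore] -/
theorem PadicLimitUnrefinedR_of (h1 : _Goal.stub_distinctRoots) (h2 : _Goal.stub_repeatedRootApproximation)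
    (h3 : _Goal.stub_regularWeightLifting) :
    Summit.Langlands.Langlands.Theses.RepeatedRootSocle.PadicLimitUnrefinedR := by
  -- the stub statements, as the Π-types they literally are
  have hD : type_of% @stub_distinctRoots := h1
  have hR : type_of% @stub_repeatedRootApproximation := h2
  have hL : type_of% @stub_regularWeightLifting := h3
  intro p _ hp k _ _ _ _ _ red hcpt ι R4 Pl ρ₀ ρ Sympl PSh Pure Cong BigRes Aut Lim
    h0irr h0sym h0sh h0pure h0aut hirr hsym hsh hpure hbig hcong
  by_cases hdist : ∃ v : Pl, ((p : ℕ) : NumberField.RingOfIntegers ℚ) ∈ v.asIdeal ∧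
      ∃ (g : Matrix.GeneralLinearGroup (Fin 4) (PadicAlgCl p))
          (α β : Field.absoluteGaloisGroup (v.adicCompletion ℚ) →* (PadicAlgCl p)ˣ),
          (∀ τ ∈ Literature.NumberTheory.GaloisRepresentations.absInertia (v.adicCompletion ℚ), α τ = 1 ∧ β τ = 1) ∧ (∃ τ, α τ ≠ β τ) ∧
          ∀ τ, (∀ i j : Fin 4, j < i → (g⁻¹ * ρ.toLocal v τ * g).val i j = 0) ∧
            (g⁻¹ * ρ.toLocal v τ * g).val 0 1 = 0 ∧ (g⁻¹ * ρ.toLocal v τ * g).val 2 3 = 0 ∧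
            (g⁻¹ * ρ.toLocal v τ * g).val 0 0 = algebraMap ℚ_[p] (PadicAlgCl p) (((Literature.NumberTheory.GaloisRepresentations.GaloisRep.cyclotomicCharacter (v.adicCompletion ℚ) p τ : ℤ_[p]ˣ) : ℤ_[p]) : ℚ_[p]) * α τ ∧
            (g⁻¹ * ρ.toLocal v τ * g).val 1 1 = algebraMap ℚ_[p] (PadicAlgCl p) (((Literature.NumberTheory.GaloisRepresentations.GaloisRep.cyclotomicCharacter (v.adicCompletion ℚ) p τ : ℤ_[p]ˣ) : ℤ_[p]) : ℚ_[p]) * β τ ∧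
            (g⁻¹ * ρ.toLocal v τ * g).val 2 2 = ((β τ)⁻¹ : (PadicAlgCl p)ˣ) ∧ (g⁻¹ * ρ.toLocal v τ * g).val 3 3 = ((α τ)⁻¹ : (PadicAlgCl p)ˣ)
  · -- CASE α ≠ β (p-distinguished in characteristic zero): automorphic outright, constant sequence
    have hA : Aut ρ :=
      hD p hp k red hcpt ι ρ₀ ρ h0irr h0sym h0sh h0pure h0aut hirr hsym hsh hpure hbig hcong hdist
    intro m
    refine ⟨ρ, hA, ?_⟩
    filter_upwards [hcong] with v hv
    obtain ⟨P, P', -, hP', -⟩ := hv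
    exact ⟨P', P', hP', hP', fun i => by simp⟩
  · -- CASE α = β at every presentation above p (repeated unit root): family + regular-weight lifting
    have hrep : ∀ v : Pl, ((p : ℕ) : NumberField.RingOfIntegers ℚ) ∈ v.asIdeal →
        ∃ (g : Matrix.GeneralLinearGroup (Fin 4) (PadicAlgCl p))
          (α β : Field.absoluteGaloisGroup (v.adicCompletion ℚ) →* (PadicAlgCl p)ˣ),
          (∀ τ ∈ Literature.NumberTheory.GaloisRepresentations.absInertia (v.adicCompletion ℚ), α τ = 1 ∧ β τ = 1) ∧ (∀ τ, α τ = β τ) ∧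
          ∀ τ, (∀ i j : Fin 4, j < i → (g⁻¹ * ρ.toLocal v τ * g).val i j = 0) ∧
            (g⁻¹ * ρ.toLocal v τ * g).val 0 1 = 0 ∧ (g⁻¹ * ρ.toLocal v τ * g).val 2 3 = 0 ∧
            (g⁻¹ * ρ.toLocal v τ * g).val 0 0 = algebraMap ℚ_[p] (PadicAlgCl p) (((Literature.NumberTheory.GaloisRepresentations.GaloisRep.cyclotomicCharacter (v.adicCompletion ℚ) p τ : ℤ_[p]ˣ) : ℤ_[p]) : ℚ_[p]) * α τ ∧
            (g⁻¹ * ρ.toLocal v τ * g).val 1 1 = algebraMap ℚ_[p] (PadicAlgCl p) (((Literature.NumberTheory.GaloisRepresentations.GaloisRep.cyclotomicCharacter (v.adicCompletion ℚ) p τ : ℤ_[p]ˣ) : ℤ_[p]) : ℚ_[p]) * β τ ∧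
            (g⁻¹ * ρ.toLocal v τ * g).val 2 2 = ((β τ)⁻¹ : (PadicAlgCl p)ˣ) ∧ (g⁻¹ * ρ.toLocal v τ * g).val 3 3 = ((α τ)⁻¹ : (PadicAlgCl p)ˣ) := by
      intro v hv
      have hsh' : ∃ (g : Matrix.GeneralLinearGroup (Fin 4) (PadicAlgCl p))
          (α β : Field.absoluteGaloisGroup (v.adicCompletion ℚ) →* (PadicAlgCl p)ˣ),
          (∀ τ ∈ Literature.NumberTheory.GaloisRepresentations.absInertia (v.adicCompletion ℚ), α τ = 1 ∧ β τ = 1) ∧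
          ∀ τ, (∀ i j : Fin 4, j < i → (g⁻¹ * ρ.toLocal v τ * g).val i j = 0) ∧
            (g⁻¹ * ρ.toLocal v τ * g).val 0 1 = 0 ∧ (g⁻¹ * ρ.toLocal v τ * g).val 2 3 = 0 ∧
            (g⁻¹ * ρ.toLocal v τ * g).val 0 0 = algebraMap ℚ_[p] (PadicAlgCl p) (((Literature.NumberTheory.GaloisRepresentations.GaloisRep.cyclotomicCharacter (v.adicCompletion ℚ) p τ : ℤ_[p]ˣ) : ℤ_[p]) : ℚ_[p]) * α τ ∧
            (g⁻¹ * ρ.toLocal v τ * g).val 1 1 = algebraMap ℚ_[p] (PadicAlgCl p) (((Literature.NumberTheory.GaloisRepresentations.GaloisRep.cyclotomicCharacter (v.adicCompletion ℚ) p τ : ℤ_[p]ˣ) : ℤ_[p]) : ℚ_[p]) * β τ ∧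
            (g⁻¹ * ρ.toLocal v τ * g).val 2 2 = ((β τ)⁻¹ : (PadicAlgCl p)ˣ) ∧ (g⁻¹ * ρ.toLocal v τ * g).val 3 3 = ((α τ)⁻¹ : (PadicAlgCl p)ˣ) := hsh v hv
      obtain ⟨g, α, β, hur, hshape⟩ := hsh'
      refine ⟨g, α, β, hur, fun τ => ?_, hshape⟩
      by_contra hne
      exact hdist ⟨v, hv, g, α, β, hur, ⟨τ, hne⟩, hshape⟩
    intro m
    obtain ⟨r', hsym', hord', hunr', hbig', hcong', hmod'⟩ :=
      hR p hp k red hcpt ι ρ₀ ρ h0irr h0sym h0sh h0pure h0aut hirr hsym hsh hpure hbig hcong hrep m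
    exact ⟨r', hL p hp k red hcpt ι ρ₀ r' h0irr h0sym h0sh h0pure h0aut hsym' hord' hunr' hbig' hcong',
      hmod'⟩

/-- By-name sanity check (an `example`, not a declaration of the file): the three stubs feed the composition as
they stand. -/
example : Summit.Langlands.Langlands.Theses.RepeatedRootSocle.PadicLimitUnrefinedR :=
  PadicLimitUnrefinedR_of stub_distinctRoots stub_repeatedRootApproximation stub_regularWeightLifting

end Summit.Langlands.Langlands.Cruxes.PadicLimitUnrefinedR.Birth

end
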